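import Summits.Ventures.GridStability.Models.SMIBEnergyRoaGFM
import Literature.MathematicalPhysics.PowerSystems.SMIBSynchronizationDichotomy
import HarnessLib

/-!
# GridStability/Models/SMIBGFMDichotomy — ★ #85 «G1.SMIB-DICHOTOMY-THM» read BY NAME on the G3.a instance
# of record «GFM-SMIB-QoriaV4 (phys)» (droop grid-forming converter vs. infinite bus AS an SMIB): every
# motion, from EVERY state, either converges to an equilibrium point or slips poles for ever

Venture GRIDFUSION (LADDER-GRIDFUSION G3.a / G1), cell `run/shared/lean/pub/gridfusion/`, seat
gridfusion-model-1 (g7), LOW default work (companion of «CS-LOSSLESS-DICHOTOMY» / «CS-INFBUS-DICHOTOMY»: the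
same «dichotomy on every typed object of the row» programme, here the `n = m = 1` grid-forming reading).
PATTERN = `Models/SMIBK13Dichotomy.lean` (p528999, the «SMIB-K13post-D10» instance of ★ #85): lit-1's
`Literature/MathematicalPhysics/PowerSystems/SMIBSynchronizationDichotomy.lean` (Tricomi / Leonov 2001 Ch. 4
§4.2 Thm 4.1 + case 1); §7 every initial state) through model-1's bridge `SMIB.toLit` (p479609, `γ = 0`) on
the instance records of `Models/SMIBInstanceGFM.lean` (p468783/p470417) with the certified angle facts of
`Models/SMIBEnergyRoaGFM.lean` (p483355: `0 < δˢ < π/2`, `δˢ = arcsin(2072640/16581121) ∈ (0.1253, 0.1254)`).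
NO new analysis.

CONTENTS (instance of record `gfmQoriaV4Phys`, lit-2 record `⟨113/3550, 3729/3550, 8290560/16581121, 4⟩`;
τ-time sibling `gfmQoriaV4`, record `⟨4, 4086/347, 8290560/16581121, 4⟩`):
* `gfmQoriaV4Phys_tendsto_equilibrium_or_tendsto_angle_atTop` — EVERY global motion either converges to an
  equilibrium point `(θe, 0)` or has `δ(t) → +∞` (pole slipping for ever); no third behaviour;
* `gfmQoriaV4Phys_exists_speed_pos_of_tendsto_angle_atTop` — in the second case the frequency deviation
  is negative on an initial interval `[0, T)` and POSITIVE for every `t > T`;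
* `gfmQoriaV4Phys_dichotomy_of_initialState` — from EVERY initial state `(δ₀, ω₀)` a global motion exists
  and obeys the dichotomy (lit-1 §7); the same three statements for the sibling `gfmQoriaV4`.

THREE COLUMNS (never merged). CERTIFIED (kernel, standard axioms): «in MODEL `M_smib`(GFM-SMIB-QoriaV4-phys)
— the droop grid-forming converter against an infinite bus READ AS a classical SMIB (model-3's bridge
`InverterDroop.gfmSmibQoriaV4.toGridSMIB` = `SMIB.gfmQoriaV4Phys`; MODEL-VALIDITY MV-6D filter-less + MV-P +
MV-Ω(ω_b′ = 35500/113)) — every motion from every state either converges to an equilibrium point or its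
virtual angle diverges to `+∞` with eventually positive frequency deviation». VALIDATED: nothing here (the
printed Qoria §V.4 clearing times remain the G3.a rows' VALIDATED comparators). MODELLED: a statement about
the MODEL; which alternative holds from a given state is what the G3.a ROA rows (#11/#12, energy route
`gfmQoriaV4Phys_energyWell_roa`) decide; never «the converter is (un)stable», never a device. No definition,
no named fact, no `sorry`, no kit.
-/

noncomputable section

open Real Set Filter Topology

namespace Summit.Ventures.GridStability.Models.SMIB

/-! ### Instance of record (physical reading) -/

/-- **Dichotomy for «GFM-SMIB-QoriaV4 (phys)».** Every global motion either converges to an equilibrium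
point or has `δ(t) → +∞`. (model: model-3's `InverterDroop.gfmSmibQoriaV4.toGridSMIB`, its locators there). [cite: Leonov2001, Ch. 4 §4.2 Thm 4.1 and case 1)] -/
theorem gfmQoriaV4Phys_tendsto_equilibrium_or_tendsto_angle_atTop {X : ℝ → ℝ × ℝ}
    (hX : ∀ S : ℝ, gfmQoriaV4Phys.IsSolutionOn X (Icc 0 S)) :
    (∃ θe : ℝ, gfmQoriaV4Phys.toLit.IsEquilibriumAngle θe ∧ Tendsto X atTop (𝓝 (θe, 0))) ∨
      Tendsto (fun t => (X t).1) atTop atTop := by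
  have hM : 0 < gfmQoriaV4Phys.toLit.M := by rw [gfmQoriaV4Phys_toLit]; norm_num
  have hD : 0 < gfmQoriaV4Phys.toLit.D := by rw [gfmQoriaV4Phys_toLit]; norm_num
  have hPmax : 0 < gfmQoriaV4Phys.toLit.Pmax := by rw [gfmQoriaV4Phys_toLit]; norm_num
  have heq : gfmQoriaV4Phys.toLit.IsEquilibriumAngle deltaQV4 :=
    (toLit_isEquilibriumAngle_iff (p := gfmQoriaV4Phys) rfl deltaQV4).2 gfmQoriaV4Phys_isEquilibrium
  have hXlit : ∀ S : ℝ, ∀ t ∈ Icc 0 S,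
      HasDerivWithinAt X (gfmQoriaV4Phys.toLit.vectorField (X t)) (Icc 0 S) t :=
    fun S => (isSolutionOn_iff_toLit (p := gfmQoriaV4Phys) rfl X _).1 (hX S)
  exact gfmQoriaV4Phys.toLit.tendsto_equilibrium_or_tendsto_angle_atTop hM hD hPmax heq deltaQV4_pos
    deltaQV4_lt_pi_div_two hXlit

/-- **Sign of the frequency deviation on a pole-slipping motion of «GFM-SMIB-QoriaV4 (phys)».**
[cite: Leonov2001, Ch. 4 §4.2, alternative 1) (Fig. 4.24)] -/
theorem gfmQoriaV4Phys_exists_speed_pos_of_tendsto_angle_atTop {X : ℝ → ℝ × ℝ}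
    (hX : ∀ S : ℝ, gfmQoriaV4Phys.IsSolutionOn X (Icc 0 S))
    (hesc : Tendsto (fun t => (X t).1) atTop atTop) :
    ∃ T : ℝ, 0 ≤ T ∧ (∀ t, 0 ≤ t → t < T → (X t).2 < 0) ∧ ∀ t, T < t → 0 < (X t).2 := by
  have hM : 0 < gfmQoriaV4Phys.toLit.M := by rw [gfmQoriaV4Phys_toLit]; norm_num
  have hD : 0 ≤ gfmQoriaV4Phys.toLit.D := by rw [gfmQoriaV4Phys_toLit]; norm_num
  have hPmax : 0 < gfmQoriaV4Phys.toLit.Pmax := by rw [gfmQoriaV4Phys_toLit]; norm_num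
  have heq : gfmQoriaV4Phys.toLit.IsEquilibriumAngle deltaQV4 :=
    (toLit_isEquilibriumAngle_iff (p := gfmQoriaV4Phys) rfl deltaQV4).2 gfmQoriaV4Phys_isEquilibrium
  have hXlit : ∀ S : ℝ, ∀ t ∈ Icc 0 S,
      HasDerivWithinAt X (gfmQoriaV4Phys.toLit.vectorField (X t)) (Icc 0 S) t :=
    fun S => (isSolutionOn_iff_toLit (p := gfmQoriaV4Phys) rfl X _).1 (hX S)
  exact gfmQoriaV4Phys.toLit.exists_speed_pos_of_tendsto_angle_atTop hM hD hPmax heq deltaQV4_pos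
    deltaQV4_lt_pi_div_two hXlit hesc

/-- **Every initial state** of «GFM-SMIB-QoriaV4 (phys)»: a global motion exists from every
`(δ₀, ω₀)` and it either converges to an equilibrium point or has `δ(t) → +∞` (CLASS = all states).
[cite: Leonov2001, Ch. 4 §4.2 Thm 4.1; Teschl2012, Thm. 2.2] -/
theorem gfmQoriaV4Phys_dichotomy_of_initialState (x₀ : ℝ × ℝ) :
    ∃ X : ℝ → ℝ × ℝ, X 0 = x₀ ∧ (∀ S : ℝ, gfmQoriaV4Phys.IsSolutionOn X (Icc 0 S)) ∧
      ((∃ θe : ℝ, gfmQoriaV4Phys.toLit.IsEquilibriumAngle θe ∧ Tendsto X atTop (𝓝 (θe, 0))) ∨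
        Tendsto (fun t => (X t).1) atTop atTop) := by
  have hM : 0 < gfmQoriaV4Phys.toLit.M := by rw [gfmQoriaV4Phys_toLit]; norm_num
  have hD : 0 < gfmQoriaV4Phys.toLit.D := by rw [gfmQoriaV4Phys_toLit]; norm_num
  have hPmax : 0 < gfmQoriaV4Phys.toLit.Pmax := by rw [gfmQoriaV4Phys_toLit]; norm_num
  have heq : gfmQoriaV4Phys.toLit.IsEquilibriumAngle deltaQV4 :=
    (toLit_isEquilibriumAngle_iff (p := gfmQoriaV4Phys) rfl deltaQV4).2 gfmQoriaV4Phys_isEquilibrium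
  obtain ⟨X, h0, hX, halt⟩ := gfmQoriaV4Phys.toLit.dichotomy_of_initialState hM hD hPmax heq deltaQV4_pos
    deltaQV4_lt_pi_div_two x₀
  exact ⟨X, h0, fun S => (isSolutionOn_iff_toLit (p := gfmQoriaV4Phys) rfl X _).2 (hX S), halt⟩

/-! ### τ-time sibling `gfmQoriaV4` (scaled time; same dichotomy) -/

/-- **Dichotomy for the τ-time sibling «GFM-SMIB-QoriaV4».** [cite: Leonov2001, Ch. 4 §4.2 Thm 4.1 and case 1)] -/
theorem gfmQoriaV4_tendsto_equilibrium_or_tendsto_angle_atTop {X : ℝ → ℝ × ℝ}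
    (hX : ∀ S : ℝ, gfmQoriaV4.IsSolutionOn X (Icc 0 S)) :
    (∃ θe : ℝ, gfmQoriaV4.toLit.IsEquilibriumAngle θe ∧ Tendsto X atTop (𝓝 (θe, 0))) ∨
      Tendsto (fun t => (X t).1) atTop atTop := by
  have hM : 0 < gfmQoriaV4.toLit.M := by rw [gfmQoriaV4_toLit]; norm_num
  have hD : 0 < gfmQoriaV4.toLit.D := by rw [gfmQoriaV4_toLit]; norm_num
  have hPmax : 0 < gfmQoriaV4.toLit.Pmax := by rw [gfmQoriaV4_toLit]; norm_num
  have heq : gfmQoriaV4.toLit.IsEquilibriumAngle deltaQV4 :=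
    (toLit_isEquilibriumAngle_iff (p := gfmQoriaV4) rfl deltaQV4).2 gfmQoriaV4_isEquilibrium
  have hXlit : ∀ S : ℝ, ∀ t ∈ Icc 0 S, HasDerivWithinAt X (gfmQoriaV4.toLit.vectorField (X t)) (Icc 0 S) t :=
    fun S => (isSolutionOn_iff_toLit (p := gfmQoriaV4) rfl X _).1 (hX S)
  exact gfmQoriaV4.toLit.tendsto_equilibrium_or_tendsto_angle_atTop hM hD hPmax heq deltaQV4_pos
    deltaQV4_lt_pi_div_two hXlit

/-- **Sign of the frequency deviation on a pole-slipping motion of the τ-time sibling.**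
[cite: Leonov2001, Ch. 4 §4.2, alternative 1) (Fig. 4.24)] -/
theorem gfmQoriaV4_exists_speed_pos_of_tendsto_angle_atTop {X : ℝ → ℝ × ℝ}
    (hX : ∀ S : ℝ, gfmQoriaV4.IsSolutionOn X (Icc 0 S)) (hesc : Tendsto (fun t => (X t).1) atTop atTop) :
    ∃ T : ℝ, 0 ≤ T ∧ (∀ t, 0 ≤ t → t < T → (X t).2 < 0) ∧ ∀ t, T < t → 0 < (X t).2 := by
  have hM : 0 < gfmQoriaV4.toLit.M := by rw [gfmQoriaV4_toLit]; norm_num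
  have hD : 0 ≤ gfmQoriaV4.toLit.D := by rw [gfmQoriaV4_toLit]; norm_num
  have hPmax : 0 < gfmQoriaV4.toLit.Pmax := by rw [gfmQoriaV4_toLit]; norm_num
  have heq : gfmQoriaV4.toLit.IsEquilibriumAngle deltaQV4 :=
    (toLit_isEquilibriumAngle_iff (p := gfmQoriaV4) rfl deltaQV4).2 gfmQoriaV4_isEquilibrium
  have hXlit : ∀ S : ℝ, ∀ t ∈ Icc 0 S, HasDerivWithinAt X (gfmQoriaV4.toLit.vectorField (X t)) (Icc 0 S) t :=
    fun S => (isSolutionOn_iff_toLit (p := gfmQoriaV4) rfl X _).1 (hX S)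
  exact gfmQoriaV4.toLit.exists_speed_pos_of_tendsto_angle_atTop hM hD hPmax heq deltaQV4_pos
    deltaQV4_lt_pi_div_two hXlit hesc

/-- **Every initial state** of the τ-time sibling: a global motion exists and obeys the dichotomy.
[cite: Leonov2001, Ch. 4 §4.2 Thm 4.1; Teschl2012, Thm. 2.2] -/
theorem gfmQoriaV4_dichotomy_of_initialState (x₀ : ℝ × ℝ) :
    ∃ X : ℝ → ℝ × ℝ, X 0 = x₀ ∧ (∀ S : ℝ, gfmQoriaV4.IsSolutionOn X (Icc 0 S)) ∧
      ((∃ θe : ℝ, gfmQoriaV4.toLit.IsEquilibriumAngle θe ∧ Tendsto X atTop (𝓝 (θe, 0))) ∨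
        Tendsto (fun t => (X t).1) atTop atTop) := by
  have hM : 0 < gfmQoriaV4.toLit.M := by rw [gfmQoriaV4_toLit]; norm_num
  have hD : 0 < gfmQoriaV4.toLit.D := by rw [gfmQoriaV4_toLit]; norm_num
  have hPmax : 0 < gfmQoriaV4.toLit.Pmax := by rw [gfmQoriaV4_toLit]; norm_num
  have heq : gfmQoriaV4.toLit.IsEquilibriumAngle deltaQV4 :=
    (toLit_isEquilibriumAngle_iff (p := gfmQoriaV4) rfl deltaQV4).2 gfmQoriaV4_isEquilibrium
  obtain ⟨X, h0, hX, halt⟩ := gfmQoriaV4.toLit.dichotomy_of_initialState hM hD hPmax heq deltaQV4_pos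
    deltaQV4_lt_pi_div_two x₀
  exact ⟨X, h0, fun S => (isSolutionOn_iff_toLit (p := gfmQoriaV4) rfl X _).2 (hX S), halt⟩

end Summit.Ventures.GridStability.Models.SMIB

end
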